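import Mathlib
import HarnessLib
import Summits.HubbardSuperconductivity.HubbardSuperconductivity.Theorems.KLProgrammeKLRegimeTwoVolumeTowerSpineDefs
import Summits.HubbardSuperconductivity.HubbardSuperconductivity.Theorems.KLProgrammeKLRegimeTwoVolumeSrcTowerBase
import Summits.HubbardSuperconductivity.HubbardSuperconductivity.Theorems.KLProgrammeKLRegimeTwoVolumeTorusBlocks

/-!
# Route `KLProgramme` — crux K3, VL child `KLRegimeVolumeLimitV17F2` (stmt-HubbardSuperconductivity-20440), blueprint v5 M5 / W4: THE OBJECTS OF THE BASE OF
# THE TOWER (definitions; seat hubbard-kl-k3c4-p1 g13; `--supports` 20440; definition lane)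

The state of step `0` of the nested two-volume induction is `klTowerState V … K 0 = klTowerD V … K 0 = map (toLin' (ε • klSrcAnalysisAt … 0)) 𝒱_1[K]`.  By
`…TwoVolumeSrcTowerBase.klSrcTower_eq_map_doubleBlock_doubleOne` (p591208, k3c4-p2's grid presentation `klEffectiveAction_eq_map_gridSub`) it is ONE block
substitution of the trivially doubled UV-stepped grid action on the grid `N = 4M`:

  `klTowerD V … K 0 = map (toLin' (klBaseTransfer V M β μ K)) (map (toLin' (klDoubleOne V (4M))) (klGridAction V M β U μ K))`.

This file NAMES the three objects and the canonical block structures of the grid legs, so that the BASE hypothesis `h0` of `…TwoVolumeTowerSpine` can be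
discharged (`…TwoVolumeTowerBaseTransfer`, `…TwoVolumeTowerBase`) from the grid-level two-volume step `…TwoVolumeScaleZeroTopFrame` (M4a):

* `klGridN M := 2·(2·M)`; `klGridAction V M β U μ K` — `effAction (S_Nᵀ C^K_{>Λ_1} S_N) (V_N + 𝒩_K)` on `GridLeg (GridPoint V N)`;
* `klDoubleOne V N` — the trivial doubling `(y, c) ↦ y`; `klSrcPlainBlock V M β` — the ε-scaled plain source block at slot `0`;
* `klBaseTransfer V M β μ K` — `(ε • E(F_0[K])·S_N) ⊕ (klSrcPlainBlock·S_N)` from the doubled grid legs to `SrcLabel V M 0`;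
* `klGridBlockEquiv L b M` / `klGridBlockEquivD L b M` — the canonical (doubled) block structure of the fine grid legs over the coarse ones (choice from
  `exists_gridLegBlockEquiv` / `exists_doubledEquiv`) with their defining properties;
* **`klTowerD_zero_eq_map_klBaseTransfer`** — the displayed identity.

Definitions with bodies and rfl/choice unfoldings; nothing about the model is asserted beyond p591208's identity.
-/

noncomputable section

namespace Summit.HubbardSuperconductivity.HubbardSuperconductivity.Theorems.TwoVolumeSource

set_option linter.dupNamespace false -- summit = problem name (single-conjunct summit), D-0017

open Finset Literature.MathematicalPhysics.QuantumLattice GrassmannAlgebra Literature.Probability.LatticeModels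
open Summit.HubbardSuperconductivity.HubbardSuperconductivity.Theorems.KLProgrammeLegKernels
open Summit.HubbardSuperconductivity.HubbardSuperconductivity.Theorems.KLRegimeSplit
open Summit.HubbardSuperconductivity.HubbardSuperconductivity.Theorems.EngineV8
open Summit.HubbardSuperconductivity.HubbardSuperconductivity.Theorems.TwoVolumeDefect

/-! ## §1 The grid objects of the base -/

/-- The grid size of the base: `N = 4M`. -/
abbrev klGridN (M : ℕ) : ℕ := 2 * (2 * M)

section Objects

variable (V M : ℕ) [NeZero V]

/-- **The UV-stepped grid action** `Y_1 = effAction (S_Nᵀ C^K_{>Λ_1} S_N) (V_N + 𝒩_K)` on the grid legs, `N = 4M`. [cite: BenfattoGiulianiMastropietro2006, §2.1 (2.5)] -/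
def klGridAction (β U μ : ℝ) (K : TrigPolyC4v) : GrassmannAlgebra ℂ (GridLeg (GridPoint V (klGridN M))) :=
  effAction ℂ ((hubbardGridSub V M β (klGridN M)).transpose * hubbardCovAboveCT V M β μ 0 K (klScale klE0 1) * hubbardGridSub V M β (klGridN M))
    (hubbardGridInteraction V (klGridN M) β U + hubbardGridCounterQuadratic V (klGridN M) β K)

/-- **The trivial doubling** `(y, c) ↦ y` of the grid legs. [folklore] -/
def klDoubleOne (N : ℕ) : Matrix (GridLeg (GridPoint V N) × Fin 2) (GridLeg (GridPoint V N)) ℂ :=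
  Matrix.of fun p y => if p.1 = y then 1 else 0

/-- **The ε-scaled plain source block at sector slot `0`** (rows of `ε • klSrcAnalysisAt … 0` on copy `1`). [folklore] -/
def klSrcPlainBlock (β : ℝ) : Matrix (SpaceTimeIdx V M × SectorLeg (sectorCount 0)) (HubbardFieldIdx V M) ℂ :=
  Matrix.of fun Y X => if (Y.2.1.1 : ℕ) = 0 then (((imagTimeWeight β M : ℝ) : ℂ)) *
    sectorAnalysisMatrix V M β (trivialMultiplier V M) (Y.1, (((0 : Fin 1), Y.2.1.2), Y.2.2)) X else 0

/-- **The base transfer** `T⁺_base = (ε • E(F_0[K])·S_N) ⊕ (klSrcPlainBlock·S_N)` from the doubled grid legs to `SrcLabel V M 0`. [cite: BenfattoGiulianiMastropietro2006, §2.7 (2.71)] -/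
def klBaseTransfer (β μ : ℝ) (K : TrigPolyC4v) : Matrix (SrcLabel V M 0) (GridLeg (GridPoint V (klGridN M)) × Fin 2) ℂ :=
  Matrix.of fun p' p =>
    if p'.2 = 0 ∧ p.2 = 0 then
      ((((imagTimeWeight β M : ℝ) : ℂ) • sectorAnalysisMatrix V M β (klAnisoFamily V M β μ K klE0 0)) * hubbardGridSub V M β (klGridN M)) p'.1 p.1
    else if p'.2 = 1 ∧ p.2 = 1 then (klSrcPlainBlock V M β * hubbardGridSub V M β (klGridN M)) p'.1 p.1 else 0

variable {V M}

omit [NeZero V] in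
/-- Entries of the trivial doubling. [folklore] -/
theorem klDoubleOne_apply (N : ℕ) (p : GridLeg (GridPoint V N) × Fin 2) (y : GridLeg (GridPoint V N)) :
    klDoubleOne V N p y = if p.1 = y then 1 else 0 := rfl

/-- Entries of the base transfer. [folklore] -/
theorem klBaseTransfer_apply (β μ : ℝ) (K : TrigPolyC4v) (p' : SrcLabel V M 0) (p : GridLeg (GridPoint V (klGridN M)) × Fin 2) :
    klBaseTransfer V M β μ K p' p =
      if p'.2 = 0 ∧ p.2 = 0 then
        ((((imagTimeWeight β M : ℝ) : ℂ) • sectorAnalysisMatrix V M β (klAnisoFamily V M β μ K klE0 0)) * hubbardGridSub V M β (klGridN M)) p'.1 p.1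
      else if p'.2 = 1 ∧ p.2 = 1 then (klSrcPlainBlock V M β * hubbardGridSub V M β (klGridN M)) p'.1 p.1 else 0 := rfl

/-- **THE BASE IDENTITY**: `klTowerD V … K 0 = map (toLin' klBaseTransfer) (map (toLin' klDoubleOne) klGridAction)` (`β ≠ 0`, `0 < M`).
[cite: BenfattoGiulianiMastropietro2006, §2.7 (2.70)-(2.71)] -/
theorem klTowerD_zero_eq_map_klBaseTransfer [NeZero M] {β : ℝ} (hβ : β ≠ 0) (U μ : ℝ) (K : TrigPolyC4v) :
    klTowerD V M β U μ K 0 = ExteriorAlgebra.map (Matrix.toLin' (klBaseTransfer V M β μ K))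
      (ExteriorAlgebra.map (Matrix.toLin' (klDoubleOne V (klGridN M))) (klGridAction V M β U μ K)) :=
  klSrcTower_eq_map_doubleBlock_doubleOne hβ U μ K 0 1 (by unfold klGridN; omega) (by unfold klGridN; omega) (klDoubleOne V (klGridN M)) (fun _ _ => rfl)
    (klBaseTransfer V M β μ K) (fun _ _ => rfl)

end Objects

/-! ## §2 The canonical block structures of the grid legs -/

section Blocks

variable (L b M : ℕ) [NeZero L] [NeZero (b * L)]

/-- **The canonical block structure of the fine grid legs** over the coarse ones (block of the site, residue leg). [folklore] -/
def klGridBlockEquiv : GridLeg (GridPoint (b * L) (klGridN M)) ≃ (Fin 2 → Fin b) × GridLeg (GridPoint L (klGridN M)) :=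
  Classical.choose (exists_gridLegBlockEquiv (M := b * L) (m := L) (b := b) rfl (klGridN M))

/-- Block coordinates of the canonical grid block structure. [folklore] -/
theorem klGridBlockEquiv_val (X' : GridLeg (GridPoint (b * L) (klGridN M))) (i : Fin 2) :
    ((klGridBlockEquiv L b M X').1 i : ℕ) = (X'.1.1.2 i).val / L :=
  (Classical.choose_spec (exists_gridLegBlockEquiv (M := b * L) (m := L) (b := b) rfl (klGridN M))).1 X' i

/-- Residue leg of the canonical grid block structure. [folklore] -/
theorem klGridBlockEquiv_snd (X' : GridLeg (GridPoint (b * L) (klGridN M))) :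
    (klGridBlockEquiv L b M X').2 = (((X'.1.1.1, fun i => (((X'.1.1.2 i).val : ℕ) : ZMod L)), X'.1.2), X'.2) :=
  (Classical.choose_spec (exists_gridLegBlockEquiv (M := b * L) (m := L) (b := b) rfl (klGridN M))).2 X'

/-- **The canonical DOUBLED block structure of the doubled fine grid legs.** [folklore] -/
def klGridBlockEquivD : (GridLeg (GridPoint (b * L) (klGridN M)) × Fin 2) ≃ (Fin 2 → Fin b) × (GridLeg (GridPoint L (klGridN M)) × Fin 2) :=
  Classical.choose (exists_doubledEquiv (klGridBlockEquiv L b M))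

/-- The doubled grid block structure on a doubled leg. [folklore] -/
theorem klGridBlockEquivD_apply (x : GridLeg (GridPoint (b * L) (klGridN M))) (s : Fin 2) :
    klGridBlockEquivD L b M (x, s) = ((klGridBlockEquiv L b M x).1, ((klGridBlockEquiv L b M x).2, s)) :=
  (Classical.choose_spec (exists_doubledEquiv (klGridBlockEquiv L b M))).1 x s

end Blocks

end Summit.HubbardSuperconductivity.HubbardSuperconductivity.Theorems.TwoVolumeSource

end
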